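import Literature.Barriers.PneNP.MatchingSlackPsdApproximation
import HarnessLib
import HarnessLib.Audit

/-!
# Typed cell target F-N2 (rung leaf, D-0061): stretched-exponential psd rank of the perfect-matching
# slack matrix — cell pnp-psdrank (D-0047), typed by pnp-psdrank-p2 from pnp-psdrank-p1's Sketch v9

This file ASSERTS NOTHING: it defines one statement (`def … : Prop`, tagged `@[conjecture]` = an obligation
node of our theories, NOT a published theorem) with an unfolding `example`. It is the TARGET of rung F-N2 of
the PneNP frontier ladder (stature 70–90: any superpolynomial lower bound on the psd rank / semidefinite
extension complexity of the matching polytope is OPEN — "whether the matching problem has a small SDP remains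
open" [cite: BraunEtAl2016, §1 (p. 3)]) in the stretched-exponential form `r ≥ exp(c·n^δ)` reached by
pnp-psdrank-p1's tracial-design line (`PsdRankMatchingSketch.ExpTracialAssemblyDim`: BDP hyperplane bound at the
factorisation's dimension + Chebyshev-damped exact designs, δ = 1/4 there), over the tree's matrix
`Literature.Barriers.PneNP.pmOddCutSlack n : OddSet n → PMatch n → ℝ` and
`Literature.Combinatorics.Optimization.HasPsdFactorization` (LRS Def. 1.7). HONEST FRAMING: the only method
ceiling in print is Kaniewski–Lee–de Wolf's — approximation-robust arguments certify at most `2^{Õ(√n)}`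
(`Literature.Barriers.PneNP.KaniewskiLeeDewolf2015_thm19`, [cite: KaniewskiLeeDewolf2015, Thm. 19 (p. 12)]);
a proof of this statement with `δ > 1/2` must be non-robust in that sense. Nothing here is a claim on P vs NP.

WHAT THIS IS NOT: not a theorem; not the equivariant/symmetric statement (that is
`Summit.PneNP.MatchingPsdRank.MatchingEquivariantPsdBound`).
-/

noncomputable section

namespace Summit.PneNP.MatchingPsdRank

open Literature.Barriers.PneNP Literature.Combinatorics.Optimization

/-- **F-N2 target (stretched-exponential psd rank of the matching slack matrix).** There are `δ > 0`,
`c > 0`, `n₀` such that for every even `n ≥ n₀` the odd-cut slack matrix of the perfect matching polytope of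
`K_n` (`S_{UM} = |δ(U) ∩ M| − 1`, odd `U`, perfect matchings `M`) has no psd factorization of size
`r < exp(c · n^δ)`. OPEN. [cite: BraunEtAl2016, §1 (p. 3)] [cite: KaniewskiLeeDewolf2015, Thm. 19 (p. 12)] -/
@[conjecture]
def MatchingPsdRankStretchedExp : Prop :=
  ∃ δ : ℝ, 0 < δ ∧ ∃ c : ℝ, 0 < c ∧ ∃ n₀ : ℕ, ∀ n : ℕ, n₀ ≤ n → Even n →
    ∀ r : ℕ, (r : ℝ) < Real.exp (c * (n : ℝ) ^ δ) → ¬ HasPsdFactorization (pmOddCutSlack n) r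

/-- Unfolding (the statement is exactly the displayed formula). -/
example : MatchingPsdRankStretchedExp ↔
    ∃ δ : ℝ, 0 < δ ∧ ∃ c : ℝ, 0 < c ∧ ∃ n₀ : ℕ, ∀ n : ℕ, n₀ ≤ n → Even n →
      ∀ r : ℕ, (r : ℝ) < Real.exp (c * (n : ℝ) ^ δ) →
        ¬ HasPsdFactorization (fun (U : OddSet n) (M : PMatch n) => ((cc U M : ℝ) - 1)) r :=
  Iff.rfl

end Summit.PneNP.MatchingPsdRank

end
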